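import Literature.Algebra.EuclideanLattices.DualLatticeProofs
import Literature.Algebra.EuclideanLattices.OrthogonalSumLattice
import Mathlib.Data.ZMod.QuotientGroup
import HarnessLib

/-!
# Kneser's `d`-neighbour of a unimodular Euclidean lattice attached to an isotropic vector

Topic `Literature/Algebra/EuclideanLattices`. The construction of M. Kneser (1957) as printed by
Chenevier–Lannes [ChenevierLannes2014, Ch. III §1, Prop. 1.4–1.5 and the algorithm following it]:
let `L ⊂ V` be a unimodular Euclidean lattice (`L^∨ = L`), `d ≥ 1` an integer and `u ∈ L` a vector
which is

* `d`-primitive: `⟪u, v⟫ ≡ 1 (mod d)` for some `v ∈ L` (the class of `u` generates a free rank-one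
  direct summand of `L/dL`), and
* `d²`-isotropic: `⟪u, u⟫ ≡ 0 (mod d²)` (Chenevier–Lannes' `ũ` with `q(ũ) ≡ 0 mod d²`, up to the
  factor `2` of `q(x) = x·x/2` for even lattices, see `Kneser.even_neighbour`).

Then with

  `M_d(L;u) := {x ∈ L : ⟪u, x⟫ ≡ 0 (mod d)}`            (`Kneser.inter L d u`)
  `vois_d(L;u) := M_d(L;u) + ℤ · u/d`                    (`Kneser.neighbour L d u`)

the lattice `L' = vois_d(L;u)` is again unimodular (`Kneser.dualLattice_neighbour`), and `L`, `L'`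
are `d`-NEIGHBOURS in Kneser's sense: `L ∩ L' = M_d(L;u)` (`Kneser.inf_neighbour`) has index `d` in
`L` (`Kneser.relIndex_inter_left`) and in `L'` (`Kneser.relIndex_inter_neighbour`), with `L/(L ∩ L')`
cyclic of order `d` (`Kneser.nonempty_quotient_equiv_zmod`). If moreover `L` is even and
`⟪u, u⟫ ≡ 0 (mod 2d²)` then `L'` is even (`Kneser.even_neighbour`). (The converse — every
`d`-neighbour with cyclic `L/(L ∩ L')` arises this way from a unique isotropic line of `L/dL`,
[ChenevierLannes2014, Ch. III Prop. 1.4–1.5] — is NOT formalised here.)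

This is the construction enumerated, line by line in `C_L(ℤ/d)`, by the neighbour / Kneser–Hecke
operators `T_d` on the classes of unimodular lattices of given rank
([ChenevierLannes2014, Ch. III §2]; Nebe–Venkov; the reciprocity / self-adjointness of the
resulting counts `N_d(L, L')` is `Literature/GroupTheory/Index/OrbitCountReciprocity.lean`).
Example: `L = ℤ⁸`, `d = 2`, `u = (1,…,1)` gives `vois_2(ℤ⁸; u) = E₈` in its even coordinate system
(Conway–Sloane, SPLAG Ch. 4 (97)).

## Contents

* `Kneser.inter`, `Kneser.neighbour` — the two definitions above (as `ℤ`-submodules of `V`);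
* `Kneser.relIndex_sup_span_singleton` — the index of `N` in `N + ℤw` is `d` when `d w ∈ N` and
  `k w ∈ N ⇒ d ∣ k` (cyclic extension lemma);
* `Kneser.inf_neighbour`, `Kneser.relIndex_inter_left`, `Kneser.relIndex_inter_neighbour`,
  `Kneser.nonempty_quotient_equiv_zmod` — the neighbour relation;
* `Kneser.discreteTopology_neighbour`, `Kneser.isZLattice_neighbour` (and for `inter`) — `L'` is a
  full lattice; `Kneser.covolume_inter`, `Kneser.covolume_neighbour` — `covol(M) = d · covol(L)`,
  `covol(L') = covol(L)`;
* `Kneser.neighbour_le_dualLattice` (integrality), `Kneser.dualLattice_neighbour` (**unimodularity**),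
  `Kneser.even_neighbour` (evenness).

## References

* M. Kneser, *Klassenzahlen definiter quadratischer Formen*, Arch. Math. 8 (1957) 241–250.
* G. Chenevier, J. Lannes, arXiv:1409.7616, Ch. III §1 (Déf. 1.2, Prop. 1.4, Prop. 1.5 and the
  algorithm `u ↝ vois_d(L;u)`) [ChenevierLannes2014]; Ergebnisse 69 (2019) [ChenevierLannes2019].
* J. H. Conway, N. J. A. Sloane, *SPLAG*, Ch. 4 §8.1 (97) (`E₈` as the `2`-neighbour of `ℤ⁸`).

## Design

Lattices are `ℤ`-submodules of a real inner product space `V` (as in `DualLattice.lean`);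
"unimodular" is the hypothesis `dualLattice L = L` (which contains integrality), congruences on the
real numbers `⟪u, x⟫` are written with explicit integer witnesses. Instances (`DiscreteTopology`,
`IsZLattice`) for `M_d(L;u)` and `vois_d(L;u)` depend on hypotheses and are therefore provided as
lemmas to be introduced with `haveI`; the main statements themselves are instance-free.
-/

noncomputable section

open Module MeasureTheory

namespace Literature.Algebra.EuclideanLattices

namespace Kneser

variable {V : Type*} [NormedAddCommGroup V] [InnerProductSpace ℝ V]

/-! ## The two lattices `M_d(L;u)` and `vois_d(L;u)` -/

/-- **`M_d(L;u) = {x ∈ L : ⟪u, x⟫ ≡ 0 (mod d)}`**, the common sublattice of `L` and its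
`d`-neighbour attached to `u` [ChenevierLannes2014, Ch. III §1 (algorithm following Prop. 1.5)].
[cite: ChenevierLannes2014, Ch. III Prop. 1.5 (algorithm)] -/
def inter (L : Submodule ℤ V) (d : ℕ) (u : V) : Submodule ℤ V where
  carrier := {x | x ∈ L ∧ ∃ k : ℤ, inner ℝ u x = (d : ℝ) * k}
  zero_mem' := ⟨L.zero_mem, 0, by simp⟩
  add_mem' := by
    rintro x y ⟨hx, k, hk⟩ ⟨hy, l, hl⟩
    exact ⟨L.add_mem hx hy, k + l, by rw [inner_add_right, hk, hl]; push_cast; ring⟩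
  smul_mem' := by
    rintro n x ⟨hx, k, hk⟩
    refine ⟨L.smul_mem n hx, n * k, ?_⟩
    rw [← Int.cast_smul_eq_zsmul ℝ, real_inner_smul_right, hk]
    push_cast
    ring

/-- **`vois_d(L;u) = M_d(L;u) + ℤ · (u/d)`**, Kneser's `d`-neighbour of `L` attached to the
(`d`-primitive, `d²`-isotropic) vector `u ∈ L`
[ChenevierLannes2014, Ch. III §1, algorithm following Prop. 1.5: "`vois_d(L;u)` est le réseau
engendré par `M_d(L;u)` et `ũ/d`"]. [cite: ChenevierLannes2014, Ch. III Prop. 1.5 (algorithm)] -/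
def neighbour (L : Submodule ℤ V) (d : ℕ) (u : V) : Submodule ℤ V :=
  inter L d u ⊔ Submodule.span ℤ {(d : ℝ)⁻¹ • u}

variable {L : Submodule ℤ V} {d : ℕ} {u : V}

/-- Membership in `M_d(L;u)`. [cite: ChenevierLannes2014, Ch. III Prop. 1.5 (algorithm)] -/
theorem mem_inter {x : V} : x ∈ inter L d u ↔ x ∈ L ∧ ∃ k : ℤ, inner ℝ u x = (d : ℝ) * k :=
  Iff.rfl

/-- `M_d(L;u) ⊆ L`. [cite: ChenevierLannes2014, Ch. III Prop. 1.5 (algorithm)] -/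
theorem inter_le : inter L d u ≤ L := fun _ hx => hx.1

/-- `M_d(L;u) ⊆ vois_d(L;u)`. [cite: ChenevierLannes2014, Ch. III Prop. 1.5 (algorithm)] -/
theorem inter_le_neighbour : inter L d u ≤ neighbour L d u := le_sup_left

/-- `u/d ∈ vois_d(L;u)`. [cite: ChenevierLannes2014, Ch. III Prop. 1.5 (algorithm)] -/
theorem div_mem_neighbour : (d : ℝ)⁻¹ • u ∈ neighbour L d u :=
  Submodule.mem_sup_right (Submodule.mem_span_singleton_self _)

/-- Membership in `vois_d(L;u)`: `x = m + a · (u/d)` with `m ∈ M_d(L;u)`, `a ∈ ℤ`.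
[cite: ChenevierLannes2014, Ch. III Prop. 1.5 (algorithm)] -/
theorem mem_neighbour {x : V} :
    x ∈ neighbour L d u ↔ ∃ m ∈ inter L d u, ∃ a : ℤ, m + a • ((d : ℝ)⁻¹ • u) = x := by
  rw [neighbour, Submodule.mem_sup]
  constructor
  · rintro ⟨m, hm, t, ht, rfl⟩
    obtain ⟨a, rfl⟩ := Submodule.mem_span_singleton.mp ht
    exact ⟨m, hm, a, rfl⟩
  · rintro ⟨m, hm, a, rfl⟩
    exact ⟨m, hm, _, Submodule.mem_span_singleton.mpr ⟨a, rfl⟩, rfl⟩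

/-! ## Integrality bookkeeping -/

/-- In a unimodular (hence integral) lattice all inner products are integers.
[cite: ChenevierLannes2014, Ch. III §1] -/
theorem exists_inner_eq_intCast (hL : dualLattice L = L) {x y : V} (hx : x ∈ L) (hy : y ∈ L) :
    ∃ n : ℤ, inner ℝ x y = (n : ℝ) := by
  rw [← hL] at hx
  obtain ⟨n, hn⟩ := mem_dualLattice.mp hx y hy
  exact ⟨n, hn.symm⟩

/-- `d · L ⊆ M_d(L;u)` (for `u ∈ L`, `L` unimodular). [cite: ChenevierLannes2014, Ch. III Prop. 1.5 (algorithm)] -/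
theorem natCast_smul_mem_inter (hL : dualLattice L = L) (hu : u ∈ L) {x : V} (hx : x ∈ L) :
    (d : ℤ) • x ∈ inter L d u := by
  obtain ⟨n, hn⟩ := exists_inner_eq_intCast hL hu hx
  refine ⟨L.smul_mem _ hx, n, ?_⟩
  rw [← Int.cast_smul_eq_zsmul ℝ, real_inner_smul_right, hn]
  push_cast
  ring

/-- `u ∈ M_d(L;u)` when `⟪u,u⟫ ≡ 0 (mod d²)`. [cite: ChenevierLannes2014, Ch. III Prop. 1.5 (algorithm)] -/
theorem self_mem_inter (hu : u ∈ L) (hiso : ∃ m : ℤ, inner ℝ u u = (d : ℝ) ^ 2 * m) :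
    u ∈ inter L d u := by
  obtain ⟨m, hm⟩ := hiso
  exact ⟨hu, d * m, by rw [hm]; push_cast; ring⟩

/-- `d · vois_d(L;u) ⊆ L`. [cite: ChenevierLannes2014, Ch. III Prop. 1.5 (algorithm)] -/
theorem natCast_smul_mem_of_mem_neighbour (hd : d ≠ 0) (hu : u ∈ L) {x : V}
    (hx : x ∈ neighbour L d u) : (d : ℤ) • x ∈ L := by
  obtain ⟨m, hm, a, rfl⟩ := mem_neighbour.mp hx
  rw [smul_add]
  refine L.add_mem (L.smul_mem _ (inter_le hm)) ?_
  have : (d : ℤ) • (a • ((d : ℝ)⁻¹ • u)) = a • u := by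
    rw [smul_comm, ← Int.cast_smul_eq_zsmul ℝ (d : ℤ), smul_smul]
    push_cast
    rw [mul_inv_cancel₀ (Nat.cast_ne_zero.mpr hd), one_smul]
  rw [this]
  exact L.smul_mem a hu

/-- **`d`-primitivity at work**: if `a · (u/d) ∈ L` then `d ∣ a` (pair with `v`, `⟪u,v⟫ ≡ 1 mod d`).
[cite: ChenevierLannes2014, Ch. III Prop. 1.5 (algorithm)] -/
theorem dvd_of_smul_div_mem (hL : dualLattice L = L) (hd : d ≠ 0)
    (hprim : ∃ v ∈ L, ∃ k : ℤ, inner ℝ u v = 1 + (d : ℝ) * k) {a : ℤ}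
    (ha : a • ((d : ℝ)⁻¹ • u) ∈ L) : (d : ℤ) ∣ a := by
  obtain ⟨v, hv, k, hk⟩ := hprim
  obtain ⟨n, hn⟩ := exists_inner_eq_intCast hL ha hv
  rw [← Int.cast_smul_eq_zsmul ℝ, smul_smul, real_inner_smul_left, hk] at hn
  have hd' : (d : ℝ) ≠ 0 := Nat.cast_ne_zero.mpr hd
  have h : (a : ℝ) * (1 + d * k) = d * n := by
    field_simp at hn
    linarith [hn]
  have h' : a + a * k * d = d * n := by
    have : (a : ℝ) + a * k * d = d * n := by linarith [h]
    exact_mod_cast this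
  exact ⟨n - a * k, by linarith [h']⟩

/-- **`L ∩ vois_d(L;u) = M_d(L;u)`** [ChenevierLannes2014, Ch. III Prop. 1.4: `M = L ∩ L'`].
[cite: ChenevierLannes2014, Ch. III Prop. 1.4] -/
theorem inf_neighbour (hL : dualLattice L = L) (hd : d ≠ 0) (hu : u ∈ L)
    (hprim : ∃ v ∈ L, ∃ k : ℤ, inner ℝ u v = 1 + (d : ℝ) * k)
    (hiso : ∃ m : ℤ, inner ℝ u u = (d : ℝ) ^ 2 * m) :
    L ⊓ neighbour L d u = inter L d u := by
  refine le_antisymm ?_ (le_inf inter_le inter_le_neighbour)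
  rintro x ⟨hxL, hxN⟩
  obtain ⟨m, hm, a, rfl⟩ := mem_neighbour.mp hxN
  have ha : a • ((d : ℝ)⁻¹ • u) ∈ L := by
    have := L.sub_mem hxL (inter_le hm)
    rwa [add_sub_cancel_left] at this
  obtain ⟨b, rfl⟩ := dvd_of_smul_div_mem hL hd hprim ha
  have : ((d : ℤ) * b) • ((d : ℝ)⁻¹ • u) = b • u := by
    rw [← Int.cast_smul_eq_zsmul ℝ, smul_smul]
    push_cast
    rw [mul_comm, ← mul_assoc, inv_mul_cancel₀ (Nat.cast_ne_zero.mpr hd), one_mul,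
      Int.cast_smul_eq_zsmul]
  rw [this]
  exact (inter L d u).add_mem hm ((inter L d u).smul_mem b (self_mem_inter hu hiso))

/-! ## Indices: the cyclic extension lemma and `[L : M_d(L;u)] = [vois_d(L;u) : M_d(L;u)] = d` -/

omit [InnerProductSpace ℝ V] in
/-- **Cyclic extension lemma.** If `d · w ∈ N` and `k · w ∈ N ⇒ d ∣ k`, then `N` has index `d` in
`N + ℤ w` (the quotient is cyclic of order `d`, generated by the class of `w`).
[cite: ChenevierLannes2014, Ch. III Prop. 1.4] -/
theorem relIndex_sup_span_singleton {N : Submodule ℤ V} {w : V} {d : ℕ}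
    (hdw : (d : ℤ) • w ∈ N) (hprim : ∀ k : ℤ, k • w ∈ N → (d : ℤ) ∣ k) :
    N.toAddSubgroup.relIndex (N ⊔ Submodule.span ℤ {w}).toAddSubgroup = d := by
  set P : Submodule ℤ V := N ⊔ Submodule.span ℤ {w} with hP
  have hwP : w ∈ P := Submodule.mem_sup_right (Submodule.mem_span_singleton_self w)
  set N' : AddSubgroup P := N.toAddSubgroup.addSubgroupOf P.toAddSubgroup with hN'
  let g : ℤ →+ P ⧸ N' := (QuotientAddGroup.mk' N').comp (zmultiplesHom P ⟨w, hwP⟩)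
  have hg : ∀ k : ℤ, g k = QuotientAddGroup.mk' N' (k • ⟨w, hwP⟩) := fun k => rfl
  have hg0 : ∀ k : ℤ, g k = 0 ↔ k • w ∈ N := fun k => by
    rw [hg, QuotientAddGroup.mk'_apply, QuotientAddGroup.eq_zero_iff, hN',
      AddSubgroup.mem_addSubgroupOf]
    rfl
  have hsurj : Function.Surjective g := by
    intro q
    induction q using QuotientAddGroup.induction_on with
    | H p =>
      obtain ⟨n, hn, t, ht, hsum⟩ := Submodule.mem_sup.mp p.2
      obtain ⟨k, rfl⟩ := Submodule.mem_span_singleton.mp ht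
      refine ⟨k, ?_⟩
      rw [hg, QuotientAddGroup.mk'_apply, QuotientAddGroup.eq, hN', AddSubgroup.mem_addSubgroupOf]
      change -(k • w) + (p : V) ∈ N
      rw [← hsum, neg_add_cancel_comm_assoc]  -- -(k•w) + (n + k•w) = n
      exact hn
  have hker : g.ker = AddSubgroup.zmultiples (d : ℤ) := by
    ext k
    rw [AddMonoidHom.mem_ker, hg0, Int.mem_zmultiples_iff]
    constructor
    · exact hprim k
    · rintro ⟨j, rfl⟩
      rw [mul_comm, mul_smul]
      exact N.smul_mem j hdw
  have e1 : ℤ ⧸ g.ker ≃+ P ⧸ N' := QuotientAddGroup.quotientKerEquivOfSurjective g hsurj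
  have e2 : ℤ ⧸ g.ker ≃+ ZMod d :=
    (QuotientAddGroup.quotientAddEquivOfEq hker).trans (Int.quotientZMultiplesNatEquivZMod d)
  calc N.toAddSubgroup.relIndex P.toAddSubgroup = Nat.card (P ⧸ N') := rfl
    _ = Nat.card (ℤ ⧸ g.ker) := Nat.card_congr e1.toEquiv.symm
    _ = Nat.card (ZMod d) := Nat.card_congr e2.toEquiv
    _ = d := Nat.card_zmod d

/-- The integer-valued linear form `⟪u, ·⟫` on `L` for `u ∈ L^∨` (Mathlib's
`BilinForm.dualSubmoduleToDual`). [cite: ChenevierLannes2014, Ch. III §1] -/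
theorem exists_addMonoidHom_inner (hu : u ∈ dualLattice L) :
    ∃ φ : L →+ ℤ, ∀ y : L, ((φ y : ℤ) : ℝ) = inner ℝ u (y : V) := by
  refine ⟨(LinearMap.BilinForm.dualSubmoduleToDual (innerₗ V : LinearMap.BilinForm ℝ V) L
    ⟨u, hu⟩).toAddMonoidHom, fun y => ?_⟩
  have h := LinearMap.BilinForm.dualSubmoduleParing_spec (innerₗ V : LinearMap.BilinForm ℝ V)
    (N := L) ⟨u, hu⟩ y
  rw [eq_intCast, innerₗ_apply_apply] at h
  rw [← h]
  rfl

/-- **`[L : M_d(L;u)] = d`** for a `d`-primitive `u` (`M_d(L;u)` is the kernel of the surjection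
`L → ℤ/d`, `x ↦ ⟪u, x⟫ mod d`). [cite: ChenevierLannes2014, Ch. III Prop. 1.4] -/
theorem relIndex_inter_left (hL : dualLattice L = L) (hu : u ∈ L)
    (hprim : ∃ v ∈ L, ∃ k : ℤ, inner ℝ u v = 1 + (d : ℝ) * k) :
    (inter L d u).toAddSubgroup.relIndex L.toAddSubgroup = d := by
  have hu' : u ∈ dualLattice L := by rw [hL]; exact hu
  obtain ⟨φ, hφ⟩ := exists_addMonoidHom_inner hu'
  let ψ : L →+ ZMod d := (Int.castAddHom (ZMod d)).comp φ
  have hψ : ∀ y : L, ψ y = ((φ y : ℤ) : ZMod d) := fun y => rfl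
  have hker : ψ.ker = (inter L d u).toAddSubgroup.addSubgroupOf L.toAddSubgroup := by
    ext y
    rw [AddMonoidHom.mem_ker, AddSubgroup.mem_addSubgroupOf, hψ,
      ZMod.intCast_zmod_eq_zero_iff_dvd]
    change _ ↔ (y : V) ∈ inter L d u
    rw [mem_inter]
    constructor
    · rintro ⟨k, hk⟩
      exact ⟨y.2, k, by rw [← hφ y, hk]; push_cast; ring⟩
    · rintro ⟨-, k, hk⟩
      refine ⟨k, ?_⟩
      have h := hφ y
      rw [hk] at h
      exact_mod_cast h
  have hsurj : Function.Surjective ψ := by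
    obtain ⟨v, hv, k, hk⟩ := hprim
    have hφv : φ ⟨v, hv⟩ = 1 + d * k := by
      have h := hφ ⟨v, hv⟩
      rw [hk] at h
      exact_mod_cast h
    have h1 : ψ ⟨v, hv⟩ = 1 := by
      rw [hψ, hφv]
      push_cast
      rw [ZMod.natCast_self, zero_mul, add_zero]
    intro z
    obtain ⟨n, rfl⟩ := ZMod.intCast_surjective z
    exact ⟨n • ⟨v, hv⟩, by rw [map_zsmul, h1, zsmul_one]⟩
  calc (inter L d u).toAddSubgroup.relIndex L.toAddSubgroup
      = ((inter L d u).toAddSubgroup.addSubgroupOf L.toAddSubgroup).index := rfl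
    _ = ψ.ker.index := by rw [hker]
    _ = Nat.card ψ.range := AddSubgroup.index_ker ψ
    _ = Nat.card (⊤ : AddSubgroup (ZMod d)) := by rw [AddMonoidHom.range_eq_top.mpr hsurj]
    _ = Nat.card (ZMod d) := AddSubgroup.card_top
    _ = d := Nat.card_zmod d

/-- **`L/M_d(L;u)` is cyclic of order `d`** (`≅ ℤ/d` via `x ↦ ⟪u, x⟫ mod d`), the cyclicity
required in the definition of `d`-neighbours [ChenevierLannes2014, Ch. III Déf. 1.2].
[cite: ChenevierLannes2014, Ch. III Déf. 1.2] -/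
theorem nonempty_quotient_equiv_zmod (hL : dualLattice L = L) (hu : u ∈ L)
    (hprim : ∃ v ∈ L, ∃ k : ℤ, inner ℝ u v = 1 + (d : ℝ) * k) :
    Nonempty (L ⧸ (inter L d u).toAddSubgroup.addSubgroupOf L.toAddSubgroup ≃+ ZMod d) := by
  have hu' : u ∈ dualLattice L := by rw [hL]; exact hu
  obtain ⟨φ, hφ⟩ := exists_addMonoidHom_inner hu'
  let ψ : L →+ ZMod d := (Int.castAddHom (ZMod d)).comp φ
  have hψ : ∀ y : L, ψ y = ((φ y : ℤ) : ZMod d) := fun y => rfl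
  have hker : ψ.ker = (inter L d u).toAddSubgroup.addSubgroupOf L.toAddSubgroup := by
    ext y
    rw [AddMonoidHom.mem_ker, AddSubgroup.mem_addSubgroupOf, hψ,
      ZMod.intCast_zmod_eq_zero_iff_dvd]
    change _ ↔ (y : V) ∈ inter L d u
    rw [mem_inter]
    constructor
    · rintro ⟨k, hk⟩
      exact ⟨y.2, k, by rw [← hφ y, hk]; push_cast; ring⟩
    · rintro ⟨-, k, hk⟩
      refine ⟨k, ?_⟩
      have h := hφ y
      rw [hk] at h
      exact_mod_cast h
  have hsurj : Function.Surjective ψ := by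
    obtain ⟨v, hv, k, hk⟩ := hprim
    have hφv : φ ⟨v, hv⟩ = 1 + d * k := by
      have h := hφ ⟨v, hv⟩
      rw [hk] at h
      exact_mod_cast h
    have h1 : ψ ⟨v, hv⟩ = 1 := by
      rw [hψ, hφv]
      push_cast
      rw [ZMod.natCast_self, zero_mul, add_zero]
    intro z
    obtain ⟨n, rfl⟩ := ZMod.intCast_surjective z
    exact ⟨n • ⟨v, hv⟩, by rw [map_zsmul, h1, zsmul_one]⟩
  exact ⟨(QuotientAddGroup.quotientAddEquivOfEq hker).symm.trans
    (QuotientAddGroup.quotientKerEquivOfSurjective ψ hsurj)⟩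

/-- **`[vois_d(L;u) : M_d(L;u)] = d`** (the quotient is cyclic, generated by the class of `u/d`).
[cite: ChenevierLannes2014, Ch. III Prop. 1.4] -/
theorem relIndex_inter_neighbour (hL : dualLattice L = L) (hd : d ≠ 0) (hu : u ∈ L)
    (hprim : ∃ v ∈ L, ∃ k : ℤ, inner ℝ u v = 1 + (d : ℝ) * k)
    (hiso : ∃ m : ℤ, inner ℝ u u = (d : ℝ) ^ 2 * m) :
    (inter L d u).toAddSubgroup.relIndex (neighbour L d u).toAddSubgroup = d := by
  refine relIndex_sup_span_singleton ?_ fun k hk => ?_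
  · have : (d : ℤ) • ((d : ℝ)⁻¹ • u) = u := by
      rw [← Int.cast_smul_eq_zsmul ℝ, smul_smul]
      push_cast
      rw [mul_inv_cancel₀ (Nat.cast_ne_zero.mpr hd), one_smul]
    rw [this]
    exact self_mem_inter hu hiso
  · exact dvd_of_smul_div_mem hL hd hprim (inter_le hk)

/-- **`L` and `vois_d(L;u)` are `d`-neighbours**: `L ∩ vois_d(L;u)` has index `d` in `L` …
[cite: ChenevierLannes2014, Ch. III Déf. 1.2] -/
theorem relIndex_inf_neighbour_left (hL : dualLattice L = L) (hd : d ≠ 0) (hu : u ∈ L)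
    (hprim : ∃ v ∈ L, ∃ k : ℤ, inner ℝ u v = 1 + (d : ℝ) * k)
    (hiso : ∃ m : ℤ, inner ℝ u u = (d : ℝ) ^ 2 * m) :
    (L ⊓ neighbour L d u).toAddSubgroup.relIndex L.toAddSubgroup = d := by
  rw [inf_neighbour hL hd hu hprim hiso]
  exact relIndex_inter_left hL hu hprim

/-- … and index `d` in `vois_d(L;u)`. [cite: ChenevierLannes2014, Ch. III Déf. 1.2] -/
theorem relIndex_inf_neighbour_right (hL : dualLattice L = L) (hd : d ≠ 0) (hu : u ∈ L)
    (hprim : ∃ v ∈ L, ∃ k : ℤ, inner ℝ u v = 1 + (d : ℝ) * k)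
    (hiso : ∃ m : ℤ, inner ℝ u u = (d : ℝ) ^ 2 * m) :
    (L ⊓ neighbour L d u).toAddSubgroup.relIndex (neighbour L d u).toAddSubgroup = d := by
  rw [inf_neighbour hL hd hu hprim hiso]
  exact relIndex_inter_neighbour hL hd hu hprim hiso

/-! ## `M_d(L;u)` and `vois_d(L;u)` are full lattices -/

omit [InnerProductSpace ℝ V] in
/-- A `ℤ`-submodule `P` with `d · P ⊆ N` for some `d ≠ 0` and a discrete `N` is discrete (isolation
constant `ε/d`). [cite: ChenevierLannes2014, Ch. III §1] -/
theorem discreteTopology_of_smul_le [NormedSpace ℝ V] {N P : Submodule ℤ V} [DiscreteTopology N]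
    {d : ℕ} (hd : d ≠ 0) (h : ∀ x ∈ P, (d : ℤ) • x ∈ N) : DiscreteTopology P := by
  obtain ⟨ε, hε, hN⟩ := OrthogonalSum.exists_norm_lt_imp_eq_zero V N.toAddSubgroup
  have hdpos : (0 : ℝ) < d := Nat.cast_pos.mpr (Nat.pos_of_ne_zero hd)
  refine discreteTopology_of_isOpen_singleton_zero ?_
  have hopen : IsOpen ((Subtype.val : P → V) ⁻¹' Metric.ball 0 (ε / d)) :=
    Metric.isOpen_ball.preimage continuous_subtype_val
  convert hopen using 1
  ext v
  simp only [Set.mem_singleton_iff, Set.mem_preimage, Metric.mem_ball, dist_zero_right]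
  constructor
  · rintro rfl
    rw [ZeroMemClass.coe_zero, norm_zero]
    exact div_pos hε hdpos
  · intro hv
    have hdv : (d : ℤ) • (v : V) ∈ N := h v v.2
    have hnorm : ‖(d : ℤ) • (v : V)‖ < ε := by
      rw [← Int.cast_smul_eq_zsmul ℝ, norm_smul]
      push_cast
      rw [Real.norm_of_nonneg hdpos.le]
      calc (d : ℝ) * ‖(v : V)‖ < d * (ε / d) := mul_lt_mul_of_pos_left hv hdpos
        _ = ε := mul_div_cancel₀ ε hdpos.ne'
    have h0 : (⟨(d : ℤ) • (v : V), hdv⟩ : N.toAddSubgroup) = 0 := hN _ (by simpa using hnorm)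
    have h0' : (d : ℤ) • (v : V) = 0 := by
      have := congrArg (fun x : N.toAddSubgroup => (x : V)) h0
      simpa using this
    rw [← Int.cast_smul_eq_zsmul ℝ, smul_eq_zero] at h0'
    rcases h0' with h0' | h0'
    · exact absurd (by exact_mod_cast h0') hd
    · exact Subtype.ext h0'

omit [InnerProductSpace ℝ V] in
/-- A discrete `ℤ`-submodule `P` with `d · N ⊆ P` for some `d ≠ 0` and a full lattice `N` is a full
lattice. [cite: ChenevierLannes2014, Ch. III §1] -/
theorem isZLattice_of_smul_le [NormedSpace ℝ V] {N P : Submodule ℤ V} [DiscreteTopology N]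
    [IsZLattice ℝ N] [DiscreteTopology P] {d : ℕ} (hd : d ≠ 0) (h : ∀ x ∈ N, (d : ℤ) • x ∈ P) :
    IsZLattice ℝ P := by
  refine ⟨eq_top_iff.mpr ?_⟩
  rw [← IsZLattice.span_top (L := N), Submodule.span_le]
  intro x hx
  have hdx : ((d : ℝ)⁻¹ : ℝ) • ((d : ℤ) • x) ∈ Submodule.span ℝ (P : Set V) :=
    Submodule.smul_mem _ _ (Submodule.subset_span (h x hx))
  rwa [← Int.cast_smul_eq_zsmul ℝ, smul_smul, Int.cast_natCast,
    inv_mul_cancel₀ (Nat.cast_ne_zero.mpr hd), one_smul] at hdx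

/-- `M_d(L;u)` is discrete (a submodule of the discrete `L`). [cite: ChenevierLannes2014, Ch. III §1] -/
instance discreteTopology_inter [DiscreteTopology L] : DiscreteTopology (inter L d u) :=
  DiscreteTopology.of_subset (s := (L : Set V)) inferInstance inter_le

/-- `M_d(L;u)` is a full lattice (`d · L ⊆ M_d(L;u)`). [cite: ChenevierLannes2014, Ch. III §1] -/
theorem isZLattice_inter [DiscreteTopology L] [IsZLattice ℝ L] (hL : dualLattice L = L) (hd : d ≠ 0)
    (hu : u ∈ L) : IsZLattice ℝ (inter L d u) :=
  isZLattice_of_smul_le (N := L) hd fun _ hx => natCast_smul_mem_inter hL hu hx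

/-- `vois_d(L;u)` is discrete (`d · vois_d(L;u) ⊆ L`). [cite: ChenevierLannes2014, Ch. III §1] -/
theorem discreteTopology_neighbour [DiscreteTopology L] (hd : d ≠ 0) (hu : u ∈ L) :
    DiscreteTopology (neighbour L d u) :=
  discreteTopology_of_smul_le (N := L) hd fun _ hx => natCast_smul_mem_of_mem_neighbour hd hu hx

/-- `vois_d(L;u)` is a full lattice (`d · L ⊆ M_d(L;u) ⊆ vois_d(L;u)`). [cite: ChenevierLannes2014, Ch. III §1] -/
theorem isZLattice_neighbour [DiscreteTopology L] [IsZLattice ℝ L]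
    [DiscreteTopology (neighbour L d u)] (hL : dualLattice L = L) (hd : d ≠ 0) (hu : u ∈ L) :
    IsZLattice ℝ (neighbour L d u) :=
  isZLattice_of_smul_le (N := L) hd fun _ hx =>
    inter_le_neighbour (natCast_smul_mem_inter hL hu hx)

/-! ## Covolumes -/

section Covolume

variable [FiniteDimensional ℝ V] [MeasurableSpace V] [BorelSpace V] [DiscreteTopology L]
  [IsZLattice ℝ L]

/-- **`covol(M_d(L;u)) = d · covol(L)`.** [cite: ChenevierLannes2014, Ch. III Prop. 1.4] -/
theorem covolume_inter (hL : dualLattice L = L) (hd : d ≠ 0) (hu : u ∈ L)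
    (hprim : ∃ v ∈ L, ∃ k : ℤ, inner ℝ u v = 1 + (d : ℝ) * k) :
    ZLattice.covolume (inter L d u) = d * ZLattice.covolume L := by
  haveI := isZLattice_inter hL hd hu
  have h := ZLattice.covolume_div_covolume_eq_relIndex' (inter L d u) L inter_le
  rw [relIndex_inter_left hL hu hprim] at h
  rwa [div_eq_iff (ZLattice.covolume_pos L volume).ne'] at h

/-- **`covol(vois_d(L;u)) = covol(L)`.** [cite: ChenevierLannes2014, Ch. III Prop. 1.4] -/
theorem covolume_neighbour (hL : dualLattice L = L) (hd : d ≠ 0) (hu : u ∈ L)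
    (hprim : ∃ v ∈ L, ∃ k : ℤ, inner ℝ u v = 1 + (d : ℝ) * k)
    (hiso : ∃ m : ℤ, inner ℝ u u = (d : ℝ) ^ 2 * m) :
    ZLattice.covolume (neighbour L d u) = ZLattice.covolume L := by
  haveI := isZLattice_inter hL hd hu
  haveI := discreteTopology_neighbour hd hu
  haveI := isZLattice_neighbour (L := L) (d := d) (u := u) hL hd hu
  have h := ZLattice.covolume_div_covolume_eq_relIndex' (inter L d u) (neighbour L d u)
    inter_le_neighbour
  rw [relIndex_inter_neighbour hL hd hu hprim hiso, covolume_inter hL hd hu hprim,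
    div_eq_iff (ZLattice.covolume_pos (neighbour L d u) volume).ne'] at h
  have hd' : (d : ℝ) ≠ 0 := Nat.cast_ne_zero.mpr hd
  have := mul_left_cancel₀ hd' h
  exact this.symm

end Covolume

/-! ## Integrality, unimodularity, evenness -/

/-- **`vois_d(L;u)` is integral** (`⟪x, y⟫ ∈ ℤ` on it): for `x = m + a u/d`, `y = m' + b u/d`,
`⟪x,y⟫ = ⟪m,m'⟫ + (b⟪m,u⟫ + a⟪u,m'⟫)/d + ab⟪u,u⟫/d²` and `d ∣ ⟪u,m⟫, ⟪u,m'⟫`, `d² ∣ ⟪u,u⟫`.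
[cite: ChenevierLannes2014, Ch. III Prop. 1.4] -/
theorem neighbour_le_dualLattice (hL : dualLattice L = L) (hd : d ≠ 0)
    (hiso : ∃ m : ℤ, inner ℝ u u = (d : ℝ) ^ 2 * m) :
    neighbour L d u ≤ dualLattice (neighbour L d u) := by
  intro x hx
  rw [mem_dualLattice]
  intro y hy
  obtain ⟨m, ⟨hmL, k, hk⟩, a, rfl⟩ := mem_neighbour.mp hx
  obtain ⟨m', ⟨hm'L, k', hk'⟩, b, rfl⟩ := mem_neighbour.mp hy
  obtain ⟨n, hn⟩ := exists_inner_eq_intCast hL hmL hm'L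
  obtain ⟨m₀, hm₀⟩ := hiso
  have hd' : (d : ℝ) ≠ 0 := Nat.cast_ne_zero.mpr hd
  refine ⟨n + b * k + a * k' + a * b * m₀, ?_⟩
  rw [← Int.cast_smul_eq_zsmul ℝ a, ← Int.cast_smul_eq_zsmul ℝ b, smul_smul, smul_smul,
    inner_add_left, inner_add_right, inner_add_right, real_inner_smul_left, real_inner_smul_right,
    real_inner_smul_left, real_inner_smul_right, real_inner_comm u m, hn, hk, hk', hm₀]
  push_cast
  field_simp
  ring

/-- Nested full lattices with the same covolume are equal. [cite: ChenevierLannes2014, Ch. III Prop. 1.4] -/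
theorem eq_of_le_of_covolume_eq [FiniteDimensional ℝ V] [MeasurableSpace V] [BorelSpace V]
    {E F : Submodule ℤ V} [DiscreteTopology E] [IsZLattice ℝ E] [DiscreteTopology F] [IsZLattice ℝ F]
    (hle : E ≤ F) (hcov : ZLattice.covolume E = ZLattice.covolume F) : E = F := by
  have h := ZLattice.covolume_div_covolume_eq_relIndex' E F hle
  rw [hcov, div_self (ZLattice.covolume_pos F volume).ne'] at h
  have h1 : E.toAddSubgroup.relIndex F.toAddSubgroup = 1 := by exact_mod_cast h.symm
  exact le_antisymm hle (AddSubgroup.relIndex_eq_one.mp h1)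

/-- **Kneser's theorem: `vois_d(L;u)` is unimodular** (`(L')^∨ = L'`): it is integral and has the
covolume of `L`, namely `1`. [cite: ChenevierLannes2014, Ch. III Prop. 1.4] -/
theorem dualLattice_neighbour [FiniteDimensional ℝ V] [DiscreteTopology L] [IsZLattice ℝ L]
    (hL : dualLattice L = L) (hd : d ≠ 0) (hu : u ∈ L)
    (hprim : ∃ v ∈ L, ∃ k : ℤ, inner ℝ u v = 1 + (d : ℝ) * k)
    (hiso : ∃ m : ℤ, inner ℝ u u = (d : ℝ) ^ 2 * m) :
    dualLattice (neighbour L d u) = neighbour L d u := by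
  borelize V
  haveI := discreteTopology_neighbour hd hu
  haveI := isZLattice_neighbour (L := L) (d := d) (u := u) hL hd hu
  -- `covol(L) = 1` for the unimodular `L`
  have hcovL : ZLattice.covolume L = 1 := by
    have h1 : ZLattice.covolume (dualLattice L) = (ZLattice.covolume L)⁻¹ :=
      covolume_dualLattice_holds L
    have hpos := ZLattice.covolume_pos L volume
    have h2 : ZLattice.covolume (dualLattice L) = ZLattice.covolume L := by simp_rw [hL]
    rw [h2] at h1
    have h3 : ZLattice.covolume L * ZLattice.covolume L = 1 := by
      rw [mul_eq_one_iff_eq_inv₀ hpos.ne']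
      exact h1
    nlinarith [hpos]
  have hcovN : ZLattice.covolume (neighbour L d u) = 1 := by
    rw [covolume_neighbour hL hd hu hprim hiso, hcovL]
  have hcovN' : ZLattice.covolume (dualLattice (neighbour L d u)) = 1 := by
    have h1 : ZLattice.covolume (dualLattice (neighbour L d u)) =
        (ZLattice.covolume (neighbour L d u))⁻¹ := covolume_dualLattice_holds (neighbour L d u)
    rw [h1, hcovN, inv_one]
  exact (eq_of_le_of_covolume_eq (neighbour_le_dualLattice hL hd hiso)
    (hcovN.trans hcovN'.symm)).symm

/-- **Evenness**: if `L` is even and `⟪u,u⟫ ≡ 0 (mod 2d²)` then `vois_d(L;u)` is even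
(`⟪m + a u/d, m + a u/d⟫ = ⟪m,m⟫ + 2a⟪u,m⟫/d + a²⟪u,u⟫/d²`). This is the condition
`q(ũ) ≡ 0 mod d²`, `q(x) = x·x/2`, of Chenevier–Lannes for even unimodular lattices.
[cite: ChenevierLannes2014, Ch. III Prop. 1.4] -/
theorem even_neighbour (hd : d ≠ 0) (heven : ∀ x ∈ L, ∃ n : ℤ, inner ℝ x x = 2 * n)
    (hiso2 : ∃ m : ℤ, inner ℝ u u = 2 * (d : ℝ) ^ 2 * m) {x : V} (hx : x ∈ neighbour L d u) :
    ∃ n : ℤ, inner ℝ x x = 2 * n := by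
  obtain ⟨m, ⟨hmL, k, hk⟩, a, rfl⟩ := mem_neighbour.mp hx
  obtain ⟨n, hn⟩ := heven m hmL
  obtain ⟨m₀, hm₀⟩ := hiso2
  have hd' : (d : ℝ) ≠ 0 := Nat.cast_ne_zero.mpr hd
  refine ⟨n + a * k + a * a * m₀, ?_⟩
  rw [← Int.cast_smul_eq_zsmul ℝ a, smul_smul, inner_add_left, inner_add_right, inner_add_right,
    real_inner_smul_left, real_inner_smul_right, real_inner_smul_left, real_inner_smul_right,
    real_inner_comm u m, hn, hk, hm₀]
  push_cast
  field_simp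
  ring

end Kneser

end Literature.Algebra.EuclideanLattices

end
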